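import Literature.Geometry.Riemannian.GradientSolitonIdentities
import Literature.Geometry.Lorentzian.MetricNormSqBounds
import HarnessLib

/-!
# Helper `helper_gradSq_scalarCurvature_le` of line `Sketch`
(crux `EntropyRung.ConicalGap`, stmt-SmoothPoincare4-16589)

The **pointwise gradient bound for the scalar curvature of a gradient Ricci soliton**: on a
gradient Ricci soliton `Ric + Hess f = λ g` (any `λ`, any dimension, `g` Riemannian),

  `|∇R|² ≤ 4 |Ric|² |∇f|²`  and  `g⁻¹(dR, df)² ≤ 4 |Ric|² (|∇f|²)²`

at every point. Both follow from Hamilton's identity `∇R = 2 Ric(∇f, ·)`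
(`mvfderiv_scalarCurvature_of_soliton`) and Cauchy–Schwarz for the metric square norm
`T(v, w)² ≤ |T|²_g g(v, v) g(w, w)` (`PseudoRiemannianMetric.sq_apply_le_normSq_mul`):

* `|∇R|² = dR(♯dR) = 2 Ric(♯df, ♯dR)`, so `(|∇R|²)² ≤ 4 |Ric|² g(♯df, ♯df) g(♯dR, ♯dR)
  = 4 |Ric|² |∇f|² |∇R|²`, and `|∇R|² ≥ 0`, `|Ric|² |∇f|² ≥ 0` give the first bound;
* `g⁻¹(dR, df) = dR(♯df) = 2 Ric(♯df, ♯df)`, so `g⁻¹(dR, df)² ≤ 4 |Ric|² g(♯df, ♯df)²`.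

This is the pointwise input of Munteanu–Sesum's weighted `∫ |∇R|² e^{-f} < ∞` on gradient
shrinkers. Everything here is proved; no definition and no named fact is introduced.

## References

* O. Munteanu, N. Sesum, *On gradient Ricci solitons*, J. Geom. Anal. 23 (2013) 539–561,
  proof of Thm. 1.5. [MunteanuSesum2013]
* O. Munteanu, J. Wang, *Structure at infinity for shrinking Ricci solitons*, arXiv:1606.01861,
  §2 (p. 6) (`∇S = 2 Ric(∇f)`). [MunteanuWang2016]
* R. Hamilton, *The formation of singularities in the Ricci flow*, Surveys in Differential
  Geometry 2 (1995), §20. [Hamilton1995]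
-/

noncomputable section

-- `Summit.SmoothPoincare4.SmoothPoincare4.…` (summit = problem) trips `dupNamespace` on every decl.
set_option linter.dupNamespace false

open scoped Manifold ContDiff ENNReal NNReal Topology
open MeasureTheory Set Filter
open Literature.Geometry.Lorentzian Literature.Geometry.Riemannian

namespace Summit.SmoothPoincare4.SmoothPoincare4.Theorems.ConicalGapSketch

/-! ## Pointwise bounds on a gradient Ricci soliton (any dimension, any constant) -/

section Pointwise

variable {E : Type*} [NormedAddCommGroup E] [NormedSpace ℝ E] [FiniteDimensional ℝ E]
  {H : Type*} [TopologicalSpace H] {I : ModelWithCorners ℝ E H} [I.Boundaryless]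
  {M : Type*} [TopologicalSpace M] [ChartedSpace H M] [IsManifold I ∞ M]
  {g : PseudoRiemannianMetric I ∞ E (TangentSpace I : M → Type _)} [g.HasLeviCivita]
  {f : M → ℝ} {lam : ℝ}

/-- **`g⁻¹(dR, dψ) = 2 Ric(♯df, ♯dψ)` on a gradient Ricci soliton** `Ric + Hess f = λ g`, for every
function `ψ`: `g⁻¹(dR, dψ) = dR(♯dψ)` and Hamilton's identity `dR = 2 Ric(♯df, ·)`
(`mvfderiv_scalarCurvature_of_soliton`). -/
theorem gradScalarBound_innerDual_eq (hf : ContMDiff I 𝓘(ℝ, ℝ) ∞ f)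
    (hsol : ∀ (x : M) (X Y : TangentSpace I x),
      g.ricci x X Y + g.hessian f x X Y = lam * g.val x X Y)
    (x : M) (ψ : M → ℝ) :
    g.innerDual x (mvfderiv I g.scalarCurvature x).toLinearMap (mvfderiv I ψ x).toLinearMap =
      2 * g.ricci x (g.sharp x (mvfderiv I f x).toLinearMap)
        (g.sharp x (mvfderiv I ψ x).toLinearMap) := by
  simp only [PseudoRiemannianMetric.innerDual, ContinuousLinearMap.coe_coe]
  exact mvfderiv_scalarCurvature_of_soliton g hf hsol x _

/-- **`|∇R|² ≤ 4 |Ric|² |∇f|²` on a gradient Ricci soliton** `Ric + Hess f = λ g` with `g`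
Riemannian: `|∇R|² = 2 Ric(♯df, ♯dR)` (`gradScalarBound_innerDual_eq`), Cauchy–Schwarz
`Ric(♯df, ♯dR)² ≤ |Ric|² g(♯df, ♯df) g(♯dR, ♯dR) = |Ric|² |∇f|² |∇R|²`
(`sq_apply_le_normSq_mul`, `innerDual_eq_val_sharp_sharp`), and cancellation of the nonnegative
factor `|∇R|²`. -/
theorem gradScalarBound_gradSq_le (hg : g.IsRiemannian) (hf : ContMDiff I 𝓘(ℝ, ℝ) ∞ f)
    (hsol : ∀ (x : M) (X Y : TangentSpace I x),
      g.ricci x X Y + g.hessian f x X Y = lam * g.val x X Y)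
    (x : M) :
    g.gradSq g.scalarCurvature x ≤ 4 * g.normSq x (g.ricci x) * g.gradSq f x := by
  -- notation: `A = |∇R|²`, `B = |∇f|²`, `N = |Ric|²`
  set v := g.sharp x (mvfderiv I f x).toLinearMap
  set w := g.sharp x (mvfderiv I g.scalarCurvature x).toLinearMap
  have hA : g.gradSq g.scalarCurvature x = 2 * g.ricci x v w :=
    gradScalarBound_innerDual_eq hf hsol x g.scalarCurvature
  have hAval : g.gradSq g.scalarCurvature x = g.val x w w := by
    rw [PseudoRiemannianMetric.gradSq, PseudoRiemannianMetric.innerDual_eq_val_sharp_sharp]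
  have hBval : g.gradSq f x = g.val x v v := by
    rw [PseudoRiemannianMetric.gradSq, PseudoRiemannianMetric.innerDual_eq_val_sharp_sharp]
  have hA0 : 0 ≤ g.gradSq g.scalarCurvature x := by
    rw [hAval]
    by_cases h0 : w = 0
    · rw [h0]; simp
    · exact (hg x w h0).le
  have hB0 : 0 ≤ g.gradSq f x := by
    rw [hBval]
    by_cases h0 : v = 0
    · rw [h0]; simp
    · exact (hg x v h0).le
  have hN0 : 0 ≤ g.normSq x (g.ricci x) := g.normSq_nonneg x hg _
  have hCS := g.sq_apply_le_normSq_mul x hg (g.ricci x) v w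
  rw [← hAval, ← hBval] at hCS
  -- `A² ≤ 4 N B A`
  have hsq : g.gradSq g.scalarCurvature x * g.gradSq g.scalarCurvature x ≤
      4 * g.normSq x (g.ricci x) * g.gradSq f x * g.gradSq g.scalarCurvature x := by
    nlinarith [hCS, hA]
  rcases hA0.lt_or_eq with hpos | hzero
  · exact le_of_mul_le_mul_right hsq hpos
  · rw [← hzero]
    exact mul_nonneg (mul_nonneg (by norm_num) hN0) hB0

/-- **`g⁻¹(dR, df)² ≤ 4 |Ric|² (|∇f|²)²` on a gradient Ricci soliton** `Ric + Hess f = λ g` with `g`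
Riemannian: `g⁻¹(dR, df) = 2 Ric(♯df, ♯df)` (`gradScalarBound_innerDual_eq`) and Cauchy–Schwarz
`Ric(♯df, ♯df)² ≤ |Ric|² g(♯df, ♯df)² = |Ric|² (|∇f|²)²` (`sq_apply_le_normSq_mul`,
`innerDual_eq_val_sharp_sharp`). -/
theorem gradScalarBound_innerDual_sq_le (hg : g.IsRiemannian) (hf : ContMDiff I 𝓘(ℝ, ℝ) ∞ f)
    (hsol : ∀ (x : M) (X Y : TangentSpace I x),
      g.ricci x X Y + g.hessian f x X Y = lam * g.val x X Y)
    (x : M) :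
    (g.innerDual x (mvfderiv I g.scalarCurvature x).toLinearMap (mvfderiv I f x).toLinearMap) ^ 2 ≤
      4 * g.normSq x (g.ricci x) * g.gradSq f x ^ 2 := by
  set v := g.sharp x (mvfderiv I f x).toLinearMap
  have hX : g.innerDual x (mvfderiv I g.scalarCurvature x).toLinearMap
      (mvfderiv I f x).toLinearMap = 2 * g.ricci x v v :=
    gradScalarBound_innerDual_eq hf hsol x f
  have hBval : g.gradSq f x = g.val x v v := by
    rw [PseudoRiemannianMetric.gradSq, PseudoRiemannianMetric.innerDual_eq_val_sharp_sharp]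
  have hCS := g.sq_apply_le_normSq_mul x hg (g.ricci x) v v
  rw [← hBval] at hCS
  rw [hX]
  nlinarith [hCS]

end Pointwise

/-! ## The registered helper -/

/-- **Helper `helper_gradSq_scalarCurvature_le` of line `Sketch`** (pointwise gradient bound for
the scalar curvature, `n = 4`): on every 4-d gradient shrinking Ricci soliton
`Ric + Hess f = g/2` with `g` Riemannian, at every point,
`|∇R|² ≤ 4 |Ric|² |∇f|²` and `g⁻¹(dR, df)² ≤ 4 |Ric|² (|∇f|²)²`:
`gradScalarBound_gradSq_le` and `gradScalarBound_innerDual_sq_le` with `λ = ½`. -/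
theorem helper_gradSq_scalarCurvature_le : ∀ (M : Type) [TopologicalSpace M] [ChartedSpace (EuclideanSpace ℝ (Fin 4)) M] [IsManifold (𝓡 4) ∞ M] (g : Literature.Geometry.Lorentzian.PseudoRiemannianMetric (𝓡 4) ∞ (EuclideanSpace ℝ (Fin 4)) (TangentSpace (𝓡 4) : M → Type _)) [g.HasLeviCivita] (f : M → ℝ), g.IsRiemannian → ContMDiff (𝓡 4) 𝓘(ℝ, ℝ) ∞ f → (∀ (x : M) (X Y : TangentSpace (𝓡 4) x), g.ricci x X Y + g.hessian f x X Y = (1 / 2 : ℝ) * g.val x X Y) → ∀ x : M, g.gradSq g.scalarCurvature x ≤ 4 * g.normSq x (g.ricci x) * g.gradSq f x ∧ (g.innerDual x (mvfderiv (𝓡 4) g.scalarCurvature x).toLinearMap (mvfderiv (𝓡 4) f x).toLinearMap) ^ 2 ≤ 4 * g.normSq x (g.ricci x) * g.gradSq f x ^ 2 := by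
  intro M _ _ _ g _ f hg hf hsol x
  exact ⟨gradScalarBound_gradSq_le hg hf hsol x, gradScalarBound_innerDual_sq_le hg hf hsol x⟩

end Summit.SmoothPoincare4.SmoothPoincare4.Theorems.ConicalGapSketch

end
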